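import Literature.AnabelianGeometry.EtaleTheta.LogDivisorModelConstantFieldGalois
import Literature.AnabelianGeometry.EtaleTheta.LogDivisorModelTateTower

/-!
# [EtTh] Def. 3.1 / Prop. 3.2 / Def. 3.3 / §3 p.72: the ARITHMETIC Tate tower — the Tate tower skeleton over a
# genuine constant field, with its Galois action `ℤ × Aut(L/K)` and its constant-field structure

S. Mochizuki, *The étale theta function …*, Publ. RIMS **45** (2009) [MochizukiEtTh2009], §3: Def. 3.1 / Prop. 3.2
(PRIMS PDF p.70), Def. 3.3 (ii)–(iii) (p.73), the constant-field functor `D₀ → D^cnst` (p.72), Prop. 3.4 (ii) (p.74);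
§1 p.12 (universal combinatorial covering of a Tate curve) [cite: MochizukiEtTh2009, Def 3.1 p.70].

CLASS (b) MODEL (abc-iut cell, W6 seat d058 lineage, gen 3; `LogDivisorModel`, `GaloisAction`, `CuspLaws`,
`GaloisAction.ConstField` and the combinatorial skeleton `LogDivisorModel.TateTower` consumed BY NAME).  The skeleton
`TateTower.model` (p444705) has constants `⟨ϖ⟩ ≅ ℤ` — no field.  Here the SAME chain geometry is built over an
honest constant field: a parameter record `TateTowerArith.Datum K L` = a finite extension `L/K` with a discrete
valuation `v : L → ℤᵐ⁰` invariant under `Aut(L/K)`, a `K`-rational parameter `q` with `v q = exp(−1)`, and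
Prop. 3.2 (iii) for the constants ("`L^×` has no infinitely divisible element `≠ 1`" — true for `L/ℚ_p` finite).  Then:
* `Datum.model : LogDivisorModel` — functions `Fn = L^× × U^ℤ` (`c·U^k`), log-divisors `ℤ^ℤ` on the chain, divisor of
  `c·U^k` = `n ↦ ord(c) + k·n` (`ord = −log ∘ v`), constants `L^×`, integral constants `O_L^▷ = {v ≤ 1}`;
  Prop. 3.2 (ii) with content (`divFun_nonneg_iff` of the skeleton: effective iff `k = 0 ∧ ord c ≥ 0`), Prop. 3.2
  (iii) from the datum; every field PROVED;
* `Datum.action : model.GaloisAction (ℤ × Aut(L/K))` — `(t, σ)·(c·U^k) = σ(c)·q^{−kt}·U^k` (translation of the chain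
  twists `U` by the `K`-rational `q`; `σ` acts on the constants), divisors translated; every law PROVED
  (`divisor_act` uses `ord q = 1`, `ord ∘ σ = ord`); `Datum.cuspLaws`;
* **`Datum.constField : action.ConstField K L ℤᵐ⁰`** (`res = snd`, `emb c = c·U^0`) — so at this model the
  Galois-correspondence binder is a THEOREM with a NON-trivial constant field: **`Datum.constGaloisLaw`**,
  `Datum.mem_constInertia_iff` (`N = ℤ × 1`).
Non-degeneracy statements and an inhabitant of `Datum` (`ℚ`, `p`-adic valuation, `q = p`): the sequel
`LogDivisorModelTateTowerArithmeticRat.lean`.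
HONEST FRAMING: a combinatorial/arithmetic consistency witness for the typed interfaces (NOT the formal-scheme
tower of a Tate curve); nothing here bears on [IUTchIII] Cor. 3.12; no side taken; typed ≠ proved.
-/

noncomputable section

namespace Literature.AnabelianGeometry.EtaleTheta

open CategoryTheory

namespace LogDivisorModel.TateTowerArith

/-- **Parameter record of the arithmetic Tate tower** (class (b)): a finite extension `L/K` of constant fields
with a discrete valuation `v` on `L` invariant under `Aut(L/K)`, a `K`-rational parameter `q` of valuation
`exp(−1)` (the Tate parameter, normalised), and Prop. 3.2 (iii) for the constants.
[cite: MochizukiEtTh2009, Def 3.1 p.70] -/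
structure Datum (K L : Type) [Field K] [Field L] [Algebra K L] : Type where
  /-- the (discrete) valuation of the constant field `L` -/
  v : Valuation L (WithZero (Multiplicative ℤ))
  /-- `L/K` is finite -/
  finiteDimensional : FiniteDimensional K L
  /-- the valuation is invariant under `Aut(L/K)` -/
  v_algEquiv : ∀ (σ : L ≃ₐ[K] L) (x : L), v (σ x) = v x
  /-- the Tate parameter, a `K`-rational constant -/
  q : K
  /-- … of normalised valuation `exp(−1)` -/
  v_q : v (algebraMap K L q) = WithZero.exp (-1)
  /-- Prop. 3.2 (iii) for constants: an infinitely divisible element of `L^×` is trivial -/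
  eq_one_of_divisible : ∀ c : Lˣ, (∀ N : ℕ+, ∃ d : Lˣ, d ^ (N : ℕ) = c) → c = 1

/-- The Galois group of the arithmetic tower over `X`: translations of the chain × `Aut(L/K)`.
[cite: MochizukiEtTh2009, Def 3.3 p.73] -/
abbrev Grp (K L : Type) [Field K] [Field L] [Algebra K L] : Type := Multiplicative ℤ × (L ≃ₐ[K] L)

variable {K L : Type} [Field K] [Field L] [Algebra K L] (D : Datum K L)

namespace Datum

/-! ## The order function of the constant field -/
/-- `v c ≠ 0` for a unit `c`. [folklore] -/
private theorem v_ne_zero (c : Lˣ) : D.v (c : L) ≠ 0 := (Valuation.ne_zero_iff _).2 c.ne_zero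

/-- The (additive, normalised) order of a nonzero constant: `ord c = −log (v c)`, so that `ord ≥ 0` on `O_L`.
[cite: MochizukiEtTh2009, Def 3.1 p.70] -/
def ord (c : Lˣ) : ℤ := -WithZero.log (D.v (c : L))

/-- `ord` is additive. [cite: MochizukiEtTh2009, Def 3.1 p.70] -/
theorem ord_mul (c d : Lˣ) : D.ord (c * d) = D.ord c + D.ord d := by
  unfold ord
  rw [Units.val_mul, map_mul, WithZero.log_mul (D.v_ne_zero c) (D.v_ne_zero d), neg_add]

/-- `ord 1 = 0`. [cite: MochizukiEtTh2009, Def 3.1 p.70] -/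
theorem ord_one : D.ord 1 = 0 := by
  unfold ord
  rw [Units.val_one, map_one, WithZero.log_one, neg_zero]

/-- `ord` as a homomorphism `L^× → ℤ`. [cite: MochizukiEtTh2009, Def 3.1 p.70] -/
def ordHom : Lˣ →* Multiplicative ℤ where
  toFun c := Multiplicative.ofAdd (D.ord c)
  map_one' := by rw [ord_one]; rfl
  map_mul' c d := by rw [ord_mul, ofAdd_add]

/-- `ord (c⁻¹) = −ord c`. [cite: MochizukiEtTh2009, Def 3.1 p.70] -/
theorem ord_inv (c : Lˣ) : D.ord c⁻¹ = -D.ord c := by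
  have h := map_inv D.ordHom c
  exact congrArg Multiplicative.toAdd h

/-- `ord (c ^ n) = n · ord c`. [cite: MochizukiEtTh2009, Def 3.1 p.70] -/
theorem ord_zpow (c : Lˣ) (n : ℤ) : D.ord (c ^ n) = n * D.ord c := by
  have h := congrArg Multiplicative.toAdd (map_zpow D.ordHom c n)
  rw [toAdd_zpow, smul_eq_mul] at h
  exact h

/-- **`O_L^▷ = {ord ≥ 0}`**: `0 ≤ ord c` iff `v c ≤ 1`. [cite: MochizukiEtTh2009, Prop 3.4 p.74] -/
theorem ord_nonneg_iff (c : Lˣ) : 0 ≤ D.ord c ↔ D.v (c : L) ≤ 1 := by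
  unfold ord
  rw [neg_nonneg, WithZero.log_le_iff_le_exp (D.v_ne_zero c), WithZero.exp_zero]

/-- `ord` is invariant under `Aut(L/K)`. [cite: MochizukiEtTh2009, Def 3.3 p.73] -/
theorem ord_map (σ : L ≃ₐ[K] L) (c : Lˣ) : D.ord (Units.map (σ : L →* L) c) = D.ord c := by
  unfold ord
  rw [Units.coe_map, MonoidHom.coe_coe, D.v_algEquiv]

/-- `q ≠ 0` in `L`. [folklore] -/
private theorem q_ne_zero : algebraMap K L D.q ≠ 0 := fun h => by
  have h' := D.v_q
  rw [h, map_zero] at h'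
  exact WithZero.exp_ne_zero h'.symm

/-- The Tate parameter as a unit of `L`. [cite: MochizukiEtTh2009, Def 3.1 p.70] -/
def qUnit : Lˣ := Units.mk0 (algebraMap K L D.q) D.q_ne_zero

/-- `ord q = 1`. [cite: MochizukiEtTh2009, Def 3.1 p.70] -/
theorem ord_qUnit : D.ord D.qUnit = 1 := by
  unfold ord qUnit
  rw [Units.val_mk0, D.v_q, WithZero.log_exp, neg_neg]

/-- `q` is `K`-rational: fixed by `Aut(L/K)`. [cite: MochizukiEtTh2009, Def 3.3 p.73] -/
theorem map_qUnit (σ : L ≃ₐ[K] L) : Units.map (σ : L →* L) D.qUnit = D.qUnit :=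
  Units.ext (by rw [Units.coe_map, MonoidHom.coe_coe]; exact σ.commutes D.q)

/-! ## Functions and divisors of the arithmetic tower -/
/-- The divisor of `c·U^k`: the function `n ↦ ord c + k·n` on the chain — the skeleton's `divFun (ord c, k)`.
[cite: MochizukiEtTh2009, Def 3.1 p.70] -/
def divFun (f : Lˣ × Multiplicative ℤ) : TateTower.Idx → ℤ :=
  TateTower.divFun (D.ord f.1, Multiplicative.toAdd f.2)

/-- `divFun` evaluated. [cite: MochizukiEtTh2009, Def 3.1 p.70] -/
theorem divFun_apply (f : Lˣ × Multiplicative ℤ) (x : TateTower.Idx) :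
    D.divFun f x = D.ord f.1 + Multiplicative.toAdd f.2 * TateTower.pos x := rfl

/-- `divFun` is additive. [cite: MochizukiEtTh2009, Def 3.1 p.70] -/
theorem divFun_mul (f g : Lˣ × Multiplicative ℤ) : D.divFun (f * g) = D.divFun f + D.divFun g := by
  funext x
  simp only [Pi.add_apply, divFun_apply, Prod.fst_mul, Prod.snd_mul, ord_mul, toAdd_mul]
  ring

/-- The divisor map `Fn = L^× × U^ℤ → DIV = ℤ^ℤ` as a homomorphism. [cite: MochizukiEtTh2009, Def 3.1 p.70] -/
def divHom : Lˣ × Multiplicative ℤ →* Multiplicative (TateTower.Idx → ℤ) where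
  toFun f := Multiplicative.ofAdd (D.divFun f)
  map_one' := by
    refine congrArg Multiplicative.ofAdd (funext fun x => ?_)
    rw [divFun_apply, Prod.fst_one, Prod.snd_one, ord_one, toAdd_one, zero_mul, add_zero, Pi.zero_apply]
  map_mul' f g := by rw [divFun_mul, ofAdd_add]

/-- `divHom` on elements. [cite: MochizukiEtTh2009, Def 3.1 p.70] -/
@[simp] theorem toAdd_divHom (f : Lˣ × Multiplicative ℤ) (x : TateTower.Idx) :
    Multiplicative.toAdd (D.divHom f) x = D.ord f.1 + Multiplicative.toAdd f.2 * TateTower.pos x := rfl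

/-- **Prop. 3.2 (ii) for the arithmetic tower, with content**: `c·U^k` has effective divisor iff `k = 0` and
`c ∈ O_L`. [cite: MochizukiEtTh2009, Prop 3.2 p.70] -/
theorem divFun_nonneg_iff (f : Lˣ × Multiplicative ℤ) :
    (∀ x, 0 ≤ D.divFun f x) ↔ Multiplicative.toAdd f.2 = 0 ∧ 0 ≤ D.ord f.1 :=
  TateTower.divFun_nonneg_iff _

/-- **The arithmetic Tate tower as an inhabitant of the Def. 3.1 / Prop. 3.2 interface** (every field proved).
[cite: MochizukiEtTh2009, Def 3.1 p.70] -/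
def model : LogDivisorModel.{0} where
  Fn := Lˣ × Multiplicative ℤ
  DIV := Multiplicative (TateTower.Idx → ℤ)
  DIVplus := TateTower.model.DIVplus
  Div := ⊤
  exists_div_eq := TateTower.model.exists_div_eq
  eq_one_of_mem_of_inv_mem := TateTower.model.eq_one_of_mem_of_inv_mem
  nonCuspidal := ⊤
  cuspidal := ⊥
  nonCuspidal_isCompl_cuspidal := isCompl_top_bot
  logMero := ⊤
  divisor := D.divHom.comp (Subgroup.subtype ⊤)
  divisor_mem_Div _ := trivial
  const := (MonoidHom.inl Lˣ (Multiplicative ℤ)).range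
  const_le_logMero := le_top
  intConst :=
    { carrier := {f | 0 ≤ D.ord f.1 ∧ f.2 = 1}
      mul_mem' := fun {a b} ha hb => by
        refine ⟨?_, ?_⟩
        · rw [Prod.fst_mul, ord_mul]; exact add_nonneg ha.1 hb.1
        · rw [Prod.snd_mul, ha.2, hb.2, mul_one]
      one_mem' := ⟨by rw [Prod.fst_one, ord_one], rfl⟩ }
  intConst_le_const := by
    rintro f ⟨-, hf⟩
    exact ⟨f.1, Prod.ext rfl hf.symm⟩
  temperedMero := ⊤
  temperedMero_le_logMero := le_rfl
  exists_pow_mem_Div := ⟨1, fun _ => trivial⟩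
  Cusp := PEmpty.{1}
  Comp := ℤ
  divPlusEquiv := TateTower.model.divPlusEquiv
  divPlusEquiv_nonCuspidal d := ⟨fun _ c => c.elim, fun _ => trivial⟩
  mem_intConst_of_divisor_mem f hf := by
    have h : ∀ x, 0 ≤ D.divFun f.1 x := hf
    rw [divFun_nonneg_iff] at h
    exact ⟨h.2, Multiplicative.toAdd.injective h.1⟩
  divisor_mem_of_mem_intConst f hf := by
    refine ⟨fun x => ?_, trivial⟩
    change 0 ≤ D.divFun f.1 x
    refine (D.divFun_nonneg_iff _).2 ⟨?_, hf.1⟩ x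
    rw [hf.2, toAdd_one]
  divisor_eq_one_iff f := by
    constructor
    · intro h
      have h' : ∀ x, D.divFun f.1 x = 0 := fun x => by
        have e := congrArg (fun d : Multiplicative (TateTower.Idx → ℤ) => Multiplicative.toAdd d x) h
        rw [toAdd_one, Pi.zero_apply] at e
        exact e
      have hk : Multiplicative.toAdd f.1.2 = 0 := by
        have h0 := h' (Sum.inr 0); have h1 := h' (Sum.inr 1)
        simp only [divFun_apply, TateTower.pos, mul_zero, add_zero, mul_one] at h0 h1
        linarith
      have hc : D.ord f.1.1 = 0 := by
        have h0 := h' (Sum.inr 0)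
        simpa [divFun_apply, TateTower.pos] using h0
      have hk' : f.1.2 = 1 := Multiplicative.toAdd.injective hk
      refine ⟨⟨hc.ge, hk'⟩, ?_, ?_⟩
      · change 0 ≤ D.ord (f.1)⁻¹.1
        rw [Prod.fst_inv, ord_inv, hc, neg_zero]
      · change (f.1)⁻¹.2 = 1
        rw [Prod.snd_inv, hk', inv_one]
    · rintro ⟨⟨hc, hk⟩, hc', -⟩
      have hc'' : D.ord f.1.1 ≤ 0 := by
        have : 0 ≤ D.ord (f.1)⁻¹.1 := hc'
        rw [Prod.fst_inv, ord_inv] at this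
        linarith
      refine Multiplicative.toAdd.injective (funext fun x => ?_)
      change D.divFun f.1 x = 0
      rw [divFun_apply, hk, toAdd_one, zero_mul, add_zero]
      exact le_antisymm hc'' hc
  eq_one_of_forall_exists_pow_eq f hf := by
    have h1 : f.1 = 1 := D.eq_one_of_divisible f.1 fun N => by
      obtain ⟨g, hg⟩ := hf N
      exact ⟨g.1, by rw [← Prod.pow_fst, hg]⟩
    have h2 : ∀ N : ℕ+, ∃ b : ℤ, ((N : ℕ) : ℤ) * b = Multiplicative.toAdd f.2 := fun N => by
      obtain ⟨g, hg⟩ := hf N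
      refine ⟨Multiplicative.toAdd g.2, ?_⟩
      have e := congrArg (fun u : Lˣ × Multiplicative ℤ => Multiplicative.toAdd u.2) hg
      simp only [Prod.pow_snd, toAdd_pow] at e
      exact e
    exact Prod.ext h1 (Multiplicative.toAdd.injective (TateTower.int_eq_zero_of_divisible _ h2))

/-! ## The Galois group `ℤ × Aut(L/K)` acting: translation twists `U` by `q`, `Aut(L/K)` acts on the constants -/

/-- The action on functions: `(t, σ)·(c·U^k) = σ(c)·q^{−kt}·U^k` (`U ∘ shift_t = q^{−t} U`).
[cite: MochizukiEtTh2009, Def 3.3 p.73] -/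
def act (g : Grp K L) (f : Lˣ × Multiplicative ℤ) : Lˣ × Multiplicative ℤ :=
  (Units.map (g.2 : L →* L) f.1 * D.qUnit ^ (-(Multiplicative.toAdd f.2 * Multiplicative.toAdd g.1)), f.2)

/-- First component of `act`. [cite: MochizukiEtTh2009, Def 3.3 p.73] -/
@[simp] theorem act_fst (g : Grp K L) (f : Lˣ × Multiplicative ℤ) : (D.act g f).1 =
    Units.map (g.2 : L →* L) f.1 * D.qUnit ^ (-(Multiplicative.toAdd f.2 * Multiplicative.toAdd g.1)) := rfl
/-- Second component of `act` (the power of `U` is unchanged). [cite: MochizukiEtTh2009, Def 3.3 p.73] -/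
@[simp] theorem act_snd (g : Grp K L) (f : Lˣ × Multiplicative ℤ) : (D.act g f).2 = f.2 := rfl

/-- `Aut(L/K)` composes on units. [folklore] -/
private theorem units_map_mul (σ τ : L ≃ₐ[K] L) (c : Lˣ) :
    Units.map ((σ * τ : L ≃ₐ[K] L) : L →* L) c = Units.map (σ : L →* L) (Units.map (τ : L →* L) c) :=
  Units.ext rfl

/-- The identity of `Aut(L/K)` acts trivially on units. [folklore] -/
private theorem units_map_one (c : Lˣ) : Units.map ((1 : L ≃ₐ[K] L) : L →* L) c = c := Units.ext rfl

/-- `act 1 = id`. [cite: MochizukiEtTh2009, Def 3.3 p.73] -/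
theorem act_one (f : Lˣ × Multiplicative ℤ) : D.act 1 f = f := by
  refine Prod.ext ?_ rfl
  rw [act_fst, Prod.snd_one, Prod.fst_one, toAdd_one, mul_zero, neg_zero, zpow_zero, mul_one, units_map_one]

/-- `act (g h) = act g ∘ act h` (uses `σ q = q`). [cite: MochizukiEtTh2009, Def 3.3 p.73] -/
theorem act_mul (g h : Grp K L) (f : Lˣ × Multiplicative ℤ) : D.act (g * h) f = D.act g (D.act h f) := by
  refine Prod.ext ?_ rfl
  rw [act_fst, act_fst, act_snd, act_fst, Prod.fst_mul, Prod.snd_mul, toAdd_mul, units_map_mul, map_mul,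
    map_zpow, map_qUnit, mul_assoc, ← zpow_add]
  congr 2
  ring

/-- `act g` is multiplicative. [cite: MochizukiEtTh2009, Def 3.3 p.73] -/
theorem act_map_mul (g : Grp K L) (f f' : Lˣ × Multiplicative ℤ) :
    D.act g (f * f') = D.act g f * D.act g f' := by
  refine Prod.ext ?_ rfl
  rw [Prod.fst_mul, act_fst, act_fst, act_fst, Prod.fst_mul, Prod.snd_mul, toAdd_mul, map_mul, add_mul,
    neg_add, zpow_add, mul_mul_mul_comm]

/-- `act g` as a multiplicative automorphism of `Fn`. [cite: MochizukiEtTh2009, Def 3.3 p.73] -/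
def actEquiv (g : Grp K L) : (Lˣ × Multiplicative ℤ) ≃* (Lˣ × Multiplicative ℤ) where
  toFun := D.act g
  invFun := D.act g⁻¹
  left_inv f := by rw [← act_mul, inv_mul_cancel, act_one]
  right_inv f := by rw [← act_mul, mul_inv_cancel, act_one]
  map_mul' := D.act_map_mul g

/-- `ℤ × Aut(L/K)` acting on the functions of the arithmetic tower. [cite: MochizukiEtTh2009, Def 3.3 p.73] -/
def actFnHom : Grp K L →* MulAut (Lˣ × Multiplicative ℤ) where
  toFun := D.actEquiv
  map_one' := MulEquiv.ext fun f => D.act_one f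
  map_mul' g h := MulEquiv.ext fun f => D.act_mul g h f

/-- `actFnHom g f = act g f`. [cite: MochizukiEtTh2009, Def 3.3 p.73] -/
@[simp] theorem actFnHom_apply (g : Grp K L) (f : Lˣ × Multiplicative ℤ) : D.actFnHom g f = D.act g f := rfl

/-- **The Galois action of `ℤ × Aut(L/K)` on the arithmetic Tate tower** (every law proved): translations act on
the chain and twist `U` by powers of `q`, `Aut(L/K)` acts on the constants. [cite: MochizukiEtTh2009, Def 3.3 p.73] -/
def action : D.model.GaloisAction (Grp K L) where
  actFn := D.actFnHom
  actDIV := TateTower.actDIVHom.comp (MonoidHom.fst _ _)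
  permCusp := 1
  permComp := TateTower.permCompHom.comp (MonoidHom.fst _ _)
  act_mem_DIVplus g d hd x := by
    change 0 ≤ Multiplicative.toAdd (TateTower.shiftDIV (Multiplicative.toAdd g.1) d) x
    rw [TateTower.toAdd_shiftDIV]
    exact hd _
  act_mem_Div _ _ _ := trivial
  act_mem_logMero _ _ _ := trivial
  act_mem_const g f hf := by
    obtain ⟨c, rfl⟩ := hf
    exact ⟨_, rfl⟩
  act_mem_intConst g f hf := by
    obtain ⟨hc, hk⟩ := hf
    refine ⟨?_, ?_⟩
    · change 0 ≤ D.ord (D.act g f).1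
      rw [act_fst, hk, toAdd_one, zero_mul, neg_zero, zpow_zero, mul_one, ord_map]
      exact hc
    · change (D.act g f).2 = 1
      rw [act_snd, hk]
  divisor_act g f := by
    refine Multiplicative.toAdd.injective (funext fun x => ?_)
    change D.divFun (D.act g f.1) x =
      Multiplicative.toAdd (TateTower.shiftDIV (Multiplicative.toAdd g.1) (D.divHom f.1)) x
    rw [divFun_apply, act_fst, act_snd, ord_mul, ord_map, ord_zpow, ord_qUnit, TateTower.toAdd_shiftDIV,
      toAdd_divHom, TateTower.pos_shiftIdx_symm]
    ring
  mult_act g d x := by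
    rcases x with c | n
    · exact c.elim
    · change (Multiplicative.toAdd (TateTower.shiftDIV (Multiplicative.toAdd g.1) d.1)
          (Sum.inr (Equiv.addRight (Multiplicative.toAdd g.1) n))).toNat =
        (Multiplicative.toAdd d.1 (Sum.inr n)).toNat
      rw [TateTower.toAdd_shiftDIV, Equiv.coe_addRight, TateTower.shiftIdx_symm_inr, add_sub_cancel_right]
      rfl

/-- The tacit cusp laws hold (no cusps; every log-divisor Cartier). [cite: MochizukiEtTh2009, Def 3.1 p.70] -/
theorem cuspLaws : D.model.CuspLaws where
  cuspidal_le_Div := bot_le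
  mem_cuspidal_iff d := by
    constructor
    · intro hd c
      have h1 : d = 1 := Subtype.ext (Subgroup.mem_bot.mp hd)
      rw [h1]
      exact D.model.mult_one _
    · intro h
      have h1 : d = 1 := D.model.eq_of_mult_eq fun x => by
        rcases x with c | n
        · exact c.elim
        · rw [h n, D.model.mult_one]
      rw [h1]
      exact Subgroup.mem_bot.mpr rfl

/-! ## The constant-field structure of the arithmetic tower and its consequences -/
/-- **The constant field of the arithmetic Tate tower**: `L/K` with `v`, `res = ` the projection `ℤ × Aut(L/K) →
Aut(L/K)`, `emb c = c·U^0`, `O_L^▷ = {v ≤ 1} = intConst`. [cite: MochizukiEtTh2009, Def 3.3 p.73] -/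
def constField : D.action.ConstField K L (WithZero (Multiplicative ℤ)) where
  v := D.v
  finiteDimensional := D.finiteDimensional
  res := MonoidHom.snd _ _
  res_surjective σ := ⟨(1, σ), rfl⟩
  emb := MonoidHom.inl _ _
  emb_injective c d h := (Prod.ext_iff.1 h).1
  range_emb := rfl
  emb_mem_intConst_iff c := by
    change (0 ≤ D.ord c ∧ (1 : Multiplicative ℤ) = 1) ↔ _
    rw [ord_nonneg_iff]
    exact ⟨fun h => h.1, fun h => ⟨h, rfl⟩⟩
  actFn_emb g c := by
    change D.act g (c, 1) = (Units.map (g.2 : L →* L) c, 1)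
    refine Prod.ext ?_ rfl
    rw [act_fst, toAdd_one, zero_mul, neg_zero, zpow_zero, mul_one]

/-- **The Galois-correspondence binder (GAP G-w6d058-2) is a THEOREM at the arithmetic Tate tower**, with a
non-trivial constant field. [cite: MochizukiEtTh2009, Thm 3.7 (iii) p.79] -/
theorem constGaloisLaw : D.action.ConstGaloisLaw := D.constField.constGaloisLaw

/-- `N = ℤ × 1`: an element acts trivially on the constants iff its `Aut(L/K)`-component is trivial.
[cite: MochizukiEtTh2009, Def 3.3 p.73] -/
theorem mem_constInertia_iff (g : Grp K L) : g ∈ D.action.constInertia ↔ g.2 = 1 :=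
  D.constField.mem_constInertia_iff g

end Datum

end LogDivisorModel.TateTowerArith

end Literature.AnabelianGeometry.EtaleTheta

end
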